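/-
Copyright (c) 2026 the pub-hodgecm-mathlib formalisation cell (harness21).  Prover seat hodgecm-mathlib-K2E3-p01 (g0), Track B ∕ K2-LIT
(build stream 29), h413 = `stmt-HodgeConjecture-24833`, line `K2_E3_EllipticInputs`, unit U3, line U3-d (lead K2E3-p03): FILE A of the ‹Ψ-package›
(DEAL SPEC K2/STATUS.md 2026-09-03T22:29:11Z) — part 4, the export to `Gqs L v = U(Φ₃)(L⁺_v)` and the head ‹SC-explicit› → ‹Ψ-package›.  2026-09-03.
-/
import Summits.HodgeConjecture.HodgeConjecture.Theorems.K2E3CayleyScalingMap       -- ★ part 3 (this seat): (E)(Z)(R)(C)(T)(S) on the model; brings parts 1–2, ★ p855173, ★ one-place model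
import Literature.NumberTheory.Rogawski1990.LocalTransferFundamentalLemma          -- ★ `IsLocSmooth`, `OrbitalMeasureFamily`, `classOrbitalIntegral`, `IsAdmissibleOn` (the (SC) vocabulary)
import HarnessLib

/-!
# h413 ∕ Track B «K2-LIT», line `K2_E3_EllipticInputs`, unit U3, line U3-d: THE CAYLEY SCALING PACKAGE ON `Gqs L v = U(Φ₃)(L⁺_v)` —
# ‹SC-explicit› (the scaling law for the unipotent orbital integrals, FILE C) ⟹ ‹Ψ-package› (the hypothesis of ★ p855276 `shalikaGermHomogeneityRayRef_of_unipotentScaling`)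

Cell `pub/hodgecm-mathlib`, crux H413 = `stmt-HodgeConjecture-24833`, route of record `HCCMUnconditional`; chair K2-lead (g0), dealer K2E3-plan (g1), line lead of U3-d
K2E3-p03 (g0) (DEAL SPEC 22:29:11Z, FILE A).  THEOREMS ONLY (no `def`, no `instance`, no `notation`, no named-fact hypothesis, no `sorry`); imports = ★ + HarnessLib; lane
`--supports stmt-HodgeConjecture-24833 --as helper` (count-neutral: with FILE C ★ the chain #3 ⟸ U3-d ⟸ ‹#3H*› ⟸ ‹Ψ-package› ⟸ ‹SC-explicit› closes row #3).

THE OBJECTS AT A NON-SPLIT PLACE (`w ∣ v`, `c̄w = w`, `e = localNonsplitEquiv : U(Φ₃)(L⁺_v) ≃ₜ* U(σ_w, Φ₃)(L_w)` ★).  For `γ ∈ Gqs L v` write `g = mat(e γ)`, `X_γ = (g − 1)(g + 1)⁻¹`.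
Given `s ∈ L_w` (`σ_w s = s`, `0 < ‖s‖ < 1`) and `0 < ρ < 1`, a pair `(Ψ, U₀)` is ADMISSIBLE when
  `hU : ∀ γ, γ ∈ U₀ ↔ det(g + 1) ∈ L_wˣ ∧ ‖c₂(χ_{X_γ})‖ ≤ ρ ∧ ‖c₁(χ_{X_γ})‖ ≤ ρ² ∧ ‖c₀(χ_{X_γ})‖ ≤ ρ³`   (the eigenvalue ball), and
  `hΨ : ∀ γ ∈ U₀, mat(e(Ψ γ)) = c(s • X_γ)`                                                          (the Cayley scaling `c ∘ (s·) ∘ c⁻¹` on it).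
‹SC-explicit› := «at every non-split `v` there are `w, s, ρ, q, a` (`1 < ‖q‖`, `a u ≥ 1` off `[1]`) such that FOR EVERY ADMISSIBLE `(Ψ, U₀)` the scaling law
`Φ_{mU}(u, 1_{U₀}·(F∘Ψ)) = q^{a u}·Φ_{mU}(u, F)` holds for unipotent `S`, admissible `mU`, `u ∈ S`, `F ∈ C_c^∞`» — FILE C's target, typed against `hU`∕`hΨ` only.
THE HEAD **`psiPackage_of_scalingLaw : ‹SC-explicit› → ‹Ψ-package›`** (conclusion = the hypothesis `hΨ` of ★ p855276 TOKEN FOR TOKEN): an admissible pair exists (★ part 2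
`exists_cayleyScaling`, pulled back along `e`), and it satisfies (U1) `U₀ ∈ 𝓝 1`, (U2) Ad-stability, (E) equivariance, (Z) `Z(γ) = Z(Ψγ)`, (R) regularity, (C) `Ψ U₀ ⊆ U₀`,
(T) `Ψ^k γ → 1`, (S) `1_{U₀}·(F∘Ψ) ∈ C_c^∞` by ★ parts 2–3 transported along the homeomorphic isomorphism `e` (§1), and (Q)+(SC) by ‹SC-explicit›.

HONEST LABEL.  HC_CM is proved only modulo the 7 printed citations (2 remaining named inputs: hLiu418 = `stmt-HodgeConjecture-24832`, h413 =
`stmt-HodgeConjecture-24833`) until rung 0 closes; this file closes no socket by itself (row #3 ∕ U3-d still rests on FILE C, the scaling law).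

## References
* [Rogawski1990] J. D. Rogawski, *Automorphic Representations of Unitary Groups in Three Variables*, Ann. of Math. Stud. 123 (1990), §8.1 Prop. 8.1.2 (b) p. 114, (8.1.1) p. 116.
* [HarishChandra1999AdmissibleDistributions] Harish-Chandra, *Admissible Invariant Distributions on Reductive p-adic Groups*, ULS 16 (1999), §3.1 Lemma 3.2; Thm. 8.1 p. 48.
* [PlatonovRapinchuk1994] V. Platonov, A. Rapinchuk, *Algebraic Groups and Number Theory* (1994), §3.3 (Cayley parametrisation), §5.1 (the one-place model).
-/

set_option autoImplicit false
-- the mandated namespace repeats the single-problem summit's segment (`HodgeConjecture.HodgeConjecture`), as in every `Theorems/*.lean` of this sub-problem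
set_option linter.dupNamespace false

noncomputable section

open NumberField IsDedekindDomain MeasureTheory Filter Topology Set
open scoped Matrix MatrixGroups
open Literature.NumberTheory.Rogawski1990 Literature.NumberTheory.Automorphic Literature.NumberTheory.Automorphic.UnitaryGroup
open Literature.NumberTheory.Weil1982.UnitaryFinTopForm Literature.NumberTheory.Rogawski1990.TypeThreeTorus
open Summit.HodgeConjecture.HodgeConjecture.Cruxes.H413.K2E3CompactCartanRegularRay
open Summit.HodgeConjecture.HodgeConjecture.Cruxes.H413.K2E3CayleyScalingModel
open Summit.HodgeConjecture.HodgeConjecture.Cruxes.H413.K2E3CayleyScalingMap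

namespace Summit.HodgeConjecture.HodgeConjecture.Cruxes.H413.K2E3CayleyScalingPackage

/-! ## §1 Pull-back of `C_c^∞` along a homeomorphism -/

/-- `IsLocSmooth` pulls back along a homeomorphism. [cite: Rogawski1990, §1.6 p. 6] -/
theorem isLocSmooth_comp_homeomorph {X Y : Type*} [TopologicalSpace X] [TopologicalSpace Y] (e : X ≃ₜ Y) {F : Y → ℂ} (hF : IsLocSmooth F) :
    IsLocSmooth (F ∘ e) :=
  ⟨hF.1.comp_continuous e.continuous, hF.2.comp_homeomorph e⟩

/-! ## §2 The head: ‹SC-explicit› ⟹ ‹Ψ-package› -/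

set_option maxHeartbeats 1600000 in
/-- **THE CAYLEY SCALING PACKAGE on the carrier `↥(UnitaryGroup.«local» L c 3 Φ₃ v)`** (which IS `Gqs L v`, ★ `cmDatum_Local` `rfl`; this is the form in which the
one-place model `e` is typed — the `Gqs L v`-typed head below is its definitional transport).  **‹SC-explicit› ⟹ ‹Ψ-package›.**  If at every non-split place `v` of `L⁺` there are `w ∣ v`, `s ∈ L_w` (`σ_w s = s`, `0 < ‖s‖ < 1`), `0 < ρ < 1`, `q`
(`1 < ‖q‖`) and exponents `a` (`a u ≥ 1` off `[1]`) such that the SCALING LAW `Φ_{mU}(u, 1_{U₀}·(F∘Ψ)) = q^{a u}·Φ_{mU}(u, F)` (unipotent `S`, admissible `mU`, `u ∈ S`,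
`F ∈ C_c^∞`) holds for EVERY pair `(Ψ, U₀)` consisting of the eigenvalue ball `U₀` of radius `ρ` and a map `Ψ` agreeing with the Cayley scaling `c ∘ (s·) ∘ c⁻¹` on it (read at `w`
through the one-place model `e`), THEN the ‹Ψ-package› — the hypothesis of ★ p855276 `K2E3ShalikaGermHomogeneityOfUnipotentScaling.shalikaGermHomogeneityRayRef_of_unipotentScaling` —
holds: such a pair exists (★ `exists_cayleyScaling`), `U₀` is an Ad-stable neighbourhood of `1`, `Ψ` is equivariant, centraliser-preserving, regularity-preserving, contracting,
`Ψ^k γ → 1`, `1_{U₀}·(F∘Ψ) ∈ C_c^∞` (★ parts 2–3, transported along `e`), and (Q)+(SC) are the scaling law.  Print: Harish-Chandra's dilation `f_t(X) = f(t⁻¹X)` of the Lie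
algebra read on the group through the Cayley chart ([HarishChandra1999] §3.1 Lemma 3.2), the mechanism behind [Rogawski1990] Prop. 8.1.2 (b) «`Γ_u(exp(t²Y)γ) = |t|^{−d(u)}Γ_u(exp(Y)γ)`».
[cite: Rogawski1990, §8.1 Prop. 8.1.2 (b) p. 114; (8.1.1) p. 116] [cite: HarishChandra1999AdmissibleDistributions, §3.1 Lemma 3.2] [cite: PlatonovRapinchuk1994, §3.3; §5.1] -/
theorem psiPackage_of_scalingLaw_local
    (hSC : ∀ (L : Type) [Field L] [NumberField L] [IsCMField L] (v : HeightOneSpectrum (𝓞 ↥(maximalRealSubfield L))),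
      (∀ w : PlacesOver L v, IsCMField.complexConj L • w.1 = w.1) →
      ∀ [MeasurableSpace (↥(«local» L (IsCMField.complexConj L) 3 (qsForm L) v))] [BorelSpace (↥(«local» L (IsCMField.complexConj L) 3 (qsForm L) v))]
        [∀ γ : ↥(«local» L (IsCMField.complexConj L) 3 (qsForm L) v), MeasurableSpace (↥(«local» L (IsCMField.complexConj L) 3 (qsForm L) v) ⧸ Subgroup.centralizer ({γ} : Set (↥(«local» L (IsCMField.complexConj L) 3 (qsForm L) v))))]
        [∀ γ : ↥(«local» L (IsCMField.complexConj L) 3 (qsForm L) v), BorelSpace (↥(«local» L (IsCMField.complexConj L) 3 (qsForm L) v) ⧸ Subgroup.centralizer ({γ} : Set (↥(«local» L (IsCMField.complexConj L) 3 (qsForm L) v))))],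
      ∃ (w : PlacesOver L v) (hw : IsCMField.complexConj L • w.1 = w.1) (s : w.1.adicCompletion L) (ρ : ℝ) (q : ℂ) (a : ConjClasses (↥(«local» L (IsCMField.complexConj L) 3 (qsForm L) v)) → ℕ),
        galAdicCompletionMap (L := L) (IsCMField.complexConj L) hw s = s ∧ s ≠ 0 ∧ ‖s‖ < 1 ∧ 0 < ρ ∧ ρ < 1 ∧ 1 < ‖q‖ ∧
        (∀ u : ConjClasses (↥(«local» L (IsCMField.complexConj L) 3 (qsForm L) v)), u ≠ ConjClasses.mk 1 → 1 ≤ a u) ∧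
        ∀ (Ψ : ↥(«local» L (IsCMField.complexConj L) 3 (qsForm L) v) → ↥(«local» L (IsCMField.complexConj L) 3 (qsForm L) v)) (U₀ : Set (↥(«local» L (IsCMField.complexConj L) 3 (qsForm L) v))),
          (∀ γ : ↥(«local» L (IsCMField.complexConj L) 3 (qsForm L) v), γ ∈ U₀ ↔
            IsUnit ((((localNonsplitEquiv (IsCMField.complexConj L) (qsForm L) (IsCMField.complexConj_ne_one L) w hw γ : ↥(unitaryGroupOfForm (galAdicCompletionMap (L := L) (IsCMField.complexConj L) hw) (placeForm (qsForm L) w.1))) : GL (Fin 3) (w.1.adicCompletion L)) : Matrix (Fin 3) (Fin 3) (w.1.adicCompletion L)) + 1).det ∧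
            ‖(((((localNonsplitEquiv (IsCMField.complexConj L) (qsForm L) (IsCMField.complexConj_ne_one L) w hw γ : ↥(unitaryGroupOfForm (galAdicCompletionMap (L := L) (IsCMField.complexConj L) hw) (placeForm (qsForm L) w.1))) : GL (Fin 3) (w.1.adicCompletion L)) : Matrix (Fin 3) (Fin 3) (w.1.adicCompletion L)) - 1) *
                ((((localNonsplitEquiv (IsCMField.complexConj L) (qsForm L) (IsCMField.complexConj_ne_one L) w hw γ : ↥(unitaryGroupOfForm (galAdicCompletionMap (L := L) (IsCMField.complexConj L) hw) (placeForm (qsForm L) w.1))) : GL (Fin 3) (w.1.adicCompletion L)) : Matrix (Fin 3) (Fin 3) (w.1.adicCompletion L)) + 1)⁻¹).charpoly.coeff 2‖ ≤ ρ ∧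
            ‖(((((localNonsplitEquiv (IsCMField.complexConj L) (qsForm L) (IsCMField.complexConj_ne_one L) w hw γ : ↥(unitaryGroupOfForm (galAdicCompletionMap (L := L) (IsCMField.complexConj L) hw) (placeForm (qsForm L) w.1))) : GL (Fin 3) (w.1.adicCompletion L)) : Matrix (Fin 3) (Fin 3) (w.1.adicCompletion L)) - 1) *
                ((((localNonsplitEquiv (IsCMField.complexConj L) (qsForm L) (IsCMField.complexConj_ne_one L) w hw γ : ↥(unitaryGroupOfForm (galAdicCompletionMap (L := L) (IsCMField.complexConj L) hw) (placeForm (qsForm L) w.1))) : GL (Fin 3) (w.1.adicCompletion L)) : Matrix (Fin 3) (Fin 3) (w.1.adicCompletion L)) + 1)⁻¹).charpoly.coeff 1‖ ≤ ρ ^ 2 ∧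
            ‖(((((localNonsplitEquiv (IsCMField.complexConj L) (qsForm L) (IsCMField.complexConj_ne_one L) w hw γ : ↥(unitaryGroupOfForm (galAdicCompletionMap (L := L) (IsCMField.complexConj L) hw) (placeForm (qsForm L) w.1))) : GL (Fin 3) (w.1.adicCompletion L)) : Matrix (Fin 3) (Fin 3) (w.1.adicCompletion L)) - 1) *
                ((((localNonsplitEquiv (IsCMField.complexConj L) (qsForm L) (IsCMField.complexConj_ne_one L) w hw γ : ↥(unitaryGroupOfForm (galAdicCompletionMap (L := L) (IsCMField.complexConj L) hw) (placeForm (qsForm L) w.1))) : GL (Fin 3) (w.1.adicCompletion L)) : Matrix (Fin 3) (Fin 3) (w.1.adicCompletion L)) + 1)⁻¹).charpoly.coeff 0‖ ≤ ρ ^ 3) →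
          (∀ γ ∈ U₀,
            (((localNonsplitEquiv (IsCMField.complexConj L) (qsForm L) (IsCMField.complexConj_ne_one L) w hw (Ψ γ) : ↥(unitaryGroupOfForm (galAdicCompletionMap (L := L) (IsCMField.complexConj L) hw) (placeForm (qsForm L) w.1))) : GL (Fin 3) (w.1.adicCompletion L)) : Matrix (Fin 3) (Fin 3) (w.1.adicCompletion L)) =
              cayley (s • (((((localNonsplitEquiv (IsCMField.complexConj L) (qsForm L) (IsCMField.complexConj_ne_one L) w hw γ : ↥(unitaryGroupOfForm (galAdicCompletionMap (L := L) (IsCMField.complexConj L) hw) (placeForm (qsForm L) w.1))) : GL (Fin 3) (w.1.adicCompletion L)) : Matrix (Fin 3) (Fin 3) (w.1.adicCompletion L)) - 1) *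
                ((((localNonsplitEquiv (IsCMField.complexConj L) (qsForm L) (IsCMField.complexConj_ne_one L) w hw γ : ↥(unitaryGroupOfForm (galAdicCompletionMap (L := L) (IsCMField.complexConj L) hw) (placeForm (qsForm L) w.1))) : GL (Fin 3) (w.1.adicCompletion L)) : Matrix (Fin 3) (Fin 3) (w.1.adicCompletion L)) + 1)⁻¹))) →
          ∀ (S : Finset (ConjClasses (↥(«local» L (IsCMField.complexConj L) 3 (qsForm L) v)))) (mU : OrbitalMeasureFamily (↥(«local» L (IsCMField.complexConj L) 3 (qsForm L) v))),
            (∀ u ∈ S, (((Quotient.out u : ↥(«local» L (IsCMField.complexConj L) 3 (qsForm L) v)).val : GL (Fin 3) (UnitaryGroup.LocalRing L v)).val - 1) ^ 3 = 0) →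
            mU.IsAdmissibleOn (fun γ : ↥(«local» L (IsCMField.complexConj L) 3 (qsForm L) v) => (ConjClasses.mk γ) ∈ S) →
            ∀ u ∈ S, ∀ F : ↥(«local» L (IsCMField.complexConj L) 3 (qsForm L) v) → ℂ, IsLocSmooth F →
              classOrbitalIntegral mU (U₀.indicator (F ∘ Ψ)) u = q ^ (a u) * classOrbitalIntegral mU F u) :
    ∀ (L : Type) [Field L] [NumberField L] [IsCMField L] (v : HeightOneSpectrum (𝓞 ↥(maximalRealSubfield L))),
      (∀ w : PlacesOver L v, IsCMField.complexConj L • w.1 = w.1) →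
      ∀ [MeasurableSpace (↥(«local» L (IsCMField.complexConj L) 3 (qsForm L) v))] [BorelSpace (↥(«local» L (IsCMField.complexConj L) 3 (qsForm L) v))]
        [∀ γ : ↥(«local» L (IsCMField.complexConj L) 3 (qsForm L) v), MeasurableSpace (↥(«local» L (IsCMField.complexConj L) 3 (qsForm L) v) ⧸ Subgroup.centralizer ({γ} : Set (↥(«local» L (IsCMField.complexConj L) 3 (qsForm L) v))))]
        [∀ γ : ↥(«local» L (IsCMField.complexConj L) 3 (qsForm L) v), BorelSpace (↥(«local» L (IsCMField.complexConj L) 3 (qsForm L) v) ⧸ Subgroup.centralizer ({γ} : Set (↥(«local» L (IsCMField.complexConj L) 3 (qsForm L) v))))],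
      ∃ (Ψ : ↥(«local» L (IsCMField.complexConj L) 3 (qsForm L) v) → ↥(«local» L (IsCMField.complexConj L) 3 (qsForm L) v)) (U₀ : Set (↥(«local» L (IsCMField.complexConj L) 3 (qsForm L) v))) (q : ℂ) (a : ConjClasses (↥(«local» L (IsCMField.complexConj L) 3 (qsForm L) v)) → ℕ),
        U₀ ∈ 𝓝 (1 : ↥(«local» L (IsCMField.complexConj L) 3 (qsForm L) v)) ∧
        (∀ γ ∈ U₀, ∀ x : ↥(«local» L (IsCMField.complexConj L) 3 (qsForm L) v), x * γ * x⁻¹ ∈ U₀) ∧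
        (∀ γ ∈ U₀, ∀ x : ↥(«local» L (IsCMField.complexConj L) 3 (qsForm L) v), Ψ (x * γ * x⁻¹) = x * Ψ γ * x⁻¹) ∧
        (∀ γ ∈ U₀, ∀ z : ↥(«local» L (IsCMField.complexConj L) 3 (qsForm L) v), z * γ = γ * z ↔ z * Ψ γ = Ψ γ * z) ∧
        (∀ γ ∈ U₀, IsRegularElt (γ : GL (Fin 3) (UnitaryGroup.LocalRing L v)) → IsRegularElt ((Ψ γ : ↥(«local» L (IsCMField.complexConj L) 3 (qsForm L) v)) : GL (Fin 3) (UnitaryGroup.LocalRing L v))) ∧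
        (∀ γ ∈ U₀, Ψ γ ∈ U₀) ∧
        (∀ γ ∈ U₀, Tendsto (fun k : ℕ => Ψ^[k] γ) atTop (𝓝 (1 : ↥(«local» L (IsCMField.complexConj L) 3 (qsForm L) v)))) ∧
        (∀ F : ↥(«local» L (IsCMField.complexConj L) 3 (qsForm L) v) → ℂ, IsLocSmooth F → IsLocSmooth (U₀.indicator (F ∘ Ψ))) ∧
        1 < ‖q‖ ∧
        (∀ u : ConjClasses (↥(«local» L (IsCMField.complexConj L) 3 (qsForm L) v)), u ≠ ConjClasses.mk 1 → 1 ≤ a u) ∧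
        ∀ (S : Finset (ConjClasses (↥(«local» L (IsCMField.complexConj L) 3 (qsForm L) v)))) (mU : OrbitalMeasureFamily (↥(«local» L (IsCMField.complexConj L) 3 (qsForm L) v))),
          (∀ u ∈ S, (((Quotient.out u : ↥(«local» L (IsCMField.complexConj L) 3 (qsForm L) v)).val : GL (Fin 3) (UnitaryGroup.LocalRing L v)).val - 1) ^ 3 = 0) →
          mU.IsAdmissibleOn (fun γ : ↥(«local» L (IsCMField.complexConj L) 3 (qsForm L) v) => (ConjClasses.mk γ) ∈ S) →
          ∀ u ∈ S, ∀ F : ↥(«local» L (IsCMField.complexConj L) 3 (qsForm L) v) → ℂ, IsLocSmooth F →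
            classOrbitalIntegral mU (U₀.indicator (F ∘ Ψ)) u = q ^ (a u) * classOrbitalIntegral mU F u := by
  intro L _ _ _ v hns _ _ _ _
  obtain ⟨w, hw, s, ρ, q, a, hσs, hs0, hs1, hρ0, hρ1, hq, ha, hlaw⟩ := hSC L v hns
  -- the one-place data
  set σ := galAdicCompletionMap (L := L) (IsCMField.complexConj L) hw with hσ_def
  set J := placeForm (qsForm L) w.1 with hJ_def
  set e := localNonsplitEquiv (IsCMField.complexConj L) (qsForm L) (IsCMField.complexConj_ne_one L) w hw with he_def
  have h2 : (2 : w.1.adicCompletion L) ≠ 0 := two_ne_zero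
  have hsρ : ‖s‖ * ρ < 1 := lt_of_le_of_lt (mul_le_of_le_one_left hρ0.le hs1.le) hρ1
  have hsρ' : ‖s⁻¹‖ * (‖s‖ * ρ) < 1 := by rwa [norm_inv, ← mul_assoc, inv_mul_cancel₀ (norm_ne_zero_iff.2 hs0), one_mul]
  have hσs' : σ s⁻¹ = s⁻¹ := by rw [map_inv₀, hσs]
  -- the eigenvalue balls of radii `ρ` and `‖s‖ρ` in the model, and the two scalings `Ψ₀` (by `s`) and `Θ` (by `s⁻¹`)
  set B : Set ↥(unitaryGroupOfForm σ J) := {u |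
    IsUnit (((u : GL (Fin 3) (w.1.adicCompletion L)) : Matrix (Fin 3) (Fin 3) (w.1.adicCompletion L)) + 1).det ∧
    ‖((((u : GL (Fin 3) (w.1.adicCompletion L)) : Matrix (Fin 3) (Fin 3) (w.1.adicCompletion L)) - 1) * (((u : GL (Fin 3) (w.1.adicCompletion L)) : Matrix (Fin 3) (Fin 3) (w.1.adicCompletion L)) + 1)⁻¹).charpoly.coeff 2‖ ≤ ρ ∧
    ‖((((u : GL (Fin 3) (w.1.adicCompletion L)) : Matrix (Fin 3) (Fin 3) (w.1.adicCompletion L)) - 1) * (((u : GL (Fin 3) (w.1.adicCompletion L)) : Matrix (Fin 3) (Fin 3) (w.1.adicCompletion L)) + 1)⁻¹).charpoly.coeff 1‖ ≤ ρ ^ 2 ∧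
    ‖((((u : GL (Fin 3) (w.1.adicCompletion L)) : Matrix (Fin 3) (Fin 3) (w.1.adicCompletion L)) - 1) * (((u : GL (Fin 3) (w.1.adicCompletion L)) : Matrix (Fin 3) (Fin 3) (w.1.adicCompletion L)) + 1)⁻¹).charpoly.coeff 0‖ ≤ ρ ^ 3} with hB_def
  have hB : ∀ u : ↥(unitaryGroupOfForm σ J), u ∈ B ↔
      IsUnit (((u : GL (Fin 3) (w.1.adicCompletion L)) : Matrix (Fin 3) (Fin 3) (w.1.adicCompletion L)) + 1).det ∧
      ‖((((u : GL (Fin 3) (w.1.adicCompletion L)) : Matrix (Fin 3) (Fin 3) (w.1.adicCompletion L)) - 1) * (((u : GL (Fin 3) (w.1.adicCompletion L)) : Matrix (Fin 3) (Fin 3) (w.1.adicCompletion L)) + 1)⁻¹).charpoly.coeff 2‖ ≤ ρ ∧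
      ‖((((u : GL (Fin 3) (w.1.adicCompletion L)) : Matrix (Fin 3) (Fin 3) (w.1.adicCompletion L)) - 1) * (((u : GL (Fin 3) (w.1.adicCompletion L)) : Matrix (Fin 3) (Fin 3) (w.1.adicCompletion L)) + 1)⁻¹).charpoly.coeff 1‖ ≤ ρ ^ 2 ∧
      ‖((((u : GL (Fin 3) (w.1.adicCompletion L)) : Matrix (Fin 3) (Fin 3) (w.1.adicCompletion L)) - 1) * (((u : GL (Fin 3) (w.1.adicCompletion L)) : Matrix (Fin 3) (Fin 3) (w.1.adicCompletion L)) + 1)⁻¹).charpoly.coeff 0‖ ≤ ρ ^ 3 :=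
    fun u => Iff.rfl
  set B' : Set ↥(unitaryGroupOfForm σ J) := {u |
    IsUnit (((u : GL (Fin 3) (w.1.adicCompletion L)) : Matrix (Fin 3) (Fin 3) (w.1.adicCompletion L)) + 1).det ∧
    ‖((((u : GL (Fin 3) (w.1.adicCompletion L)) : Matrix (Fin 3) (Fin 3) (w.1.adicCompletion L)) - 1) * (((u : GL (Fin 3) (w.1.adicCompletion L)) : Matrix (Fin 3) (Fin 3) (w.1.adicCompletion L)) + 1)⁻¹).charpoly.coeff 2‖ ≤ ‖s‖ * ρ ∧
    ‖((((u : GL (Fin 3) (w.1.adicCompletion L)) : Matrix (Fin 3) (Fin 3) (w.1.adicCompletion L)) - 1) * (((u : GL (Fin 3) (w.1.adicCompletion L)) : Matrix (Fin 3) (Fin 3) (w.1.adicCompletion L)) + 1)⁻¹).charpoly.coeff 1‖ ≤ (‖s‖ * ρ) ^ 2 ∧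
    ‖((((u : GL (Fin 3) (w.1.adicCompletion L)) : Matrix (Fin 3) (Fin 3) (w.1.adicCompletion L)) - 1) * (((u : GL (Fin 3) (w.1.adicCompletion L)) : Matrix (Fin 3) (Fin 3) (w.1.adicCompletion L)) + 1)⁻¹).charpoly.coeff 0‖ ≤ (‖s‖ * ρ) ^ 3} with hB'_def
  have hB' : ∀ u : ↥(unitaryGroupOfForm σ J), u ∈ B' ↔
      IsUnit (((u : GL (Fin 3) (w.1.adicCompletion L)) : Matrix (Fin 3) (Fin 3) (w.1.adicCompletion L)) + 1).det ∧
      ‖((((u : GL (Fin 3) (w.1.adicCompletion L)) : Matrix (Fin 3) (Fin 3) (w.1.adicCompletion L)) - 1) * (((u : GL (Fin 3) (w.1.adicCompletion L)) : Matrix (Fin 3) (Fin 3) (w.1.adicCompletion L)) + 1)⁻¹).charpoly.coeff 2‖ ≤ ‖s‖ * ρ ∧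
      ‖((((u : GL (Fin 3) (w.1.adicCompletion L)) : Matrix (Fin 3) (Fin 3) (w.1.adicCompletion L)) - 1) * (((u : GL (Fin 3) (w.1.adicCompletion L)) : Matrix (Fin 3) (Fin 3) (w.1.adicCompletion L)) + 1)⁻¹).charpoly.coeff 1‖ ≤ (‖s‖ * ρ) ^ 2 ∧
      ‖((((u : GL (Fin 3) (w.1.adicCompletion L)) : Matrix (Fin 3) (Fin 3) (w.1.adicCompletion L)) - 1) * (((u : GL (Fin 3) (w.1.adicCompletion L)) : Matrix (Fin 3) (Fin 3) (w.1.adicCompletion L)) + 1)⁻¹).charpoly.coeff 0‖ ≤ (‖s‖ * ρ) ^ 3 :=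
    fun u => Iff.rfl
  obtain ⟨Ψ₀, hΨ₀⟩ := exists_cayleyScaling σ J hB hσs hsρ
  obtain ⟨Θ, hΘ⟩ := exists_cayleyScaling σ J hB' hσs' hsρ'
  -- the objects on `↥(«local» L (IsCMField.complexConj L) 3 (qsForm L) v)`
  refine ⟨fun γ => e.symm (Ψ₀ (e γ)), {γ | e γ ∈ B}, q, a, ?_, ?_, ?_, ?_, ?_, ?_, ?_, ?_, hq, ha, ?_⟩
  · -- (U1)
    have h1 : B ∈ 𝓝 (e 1) := by rw [map_one]; exact ball_mem_nhds_one σ J hB hρ0 h2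
    exact e.continuous.continuousAt h1
  · -- (U2)
    intro γ hγ x
    show e (x * γ * x⁻¹) ∈ B
    rw [map_mul, map_mul, map_inv]
    exact conj_mem_ball σ J hB hγ (e x)
  · -- (E)
    intro γ hγ x
    apply e.injective
    rw [ContinuousMulEquiv.apply_symm_apply, map_mul, map_mul, map_inv, map_mul, map_mul, map_inv, ContinuousMulEquiv.apply_symm_apply]
    exact cayleyScaling_conj σ J hB hΨ₀ hsρ hγ (e x)
  · -- (Z)
    intro γ hγ z
    have h := comm_iff_comm_cayleyScaling σ J hB hΨ₀ h2 hs0 hsρ hγ (e z)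
    constructor
    · intro hzγ
      apply e.injective
      rw [map_mul, map_mul, ContinuousMulEquiv.apply_symm_apply]
      exact h.1 (by rw [← map_mul, ← map_mul, hzγ])
    · intro hzΨ
      apply e.injective
      rw [map_mul, map_mul]
      refine h.2 ?_
      have := congrArg e hzΨ
      rwa [map_mul, map_mul, ContinuousMulEquiv.apply_symm_apply] at this
  · -- (R)
    intro γ hγ hreg
    rw [isRegularElt_iff_separable_localNonsplitEquiv L w hw, ← he_def, ContinuousMulEquiv.apply_symm_apply]
    exact (separable_charpoly_cayleyScaling_iff σ J hB hΨ₀ h2 hs0 hsρ hγ).2 ((isRegularElt_iff_separable_localNonsplitEquiv L w hw γ).1 hreg)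
  · -- (C)
    intro γ hγ
    show e (e.symm (Ψ₀ (e γ))) ∈ B
    rw [ContinuousMulEquiv.apply_symm_apply]
    exact cayleyScaling_mem_of_ball σ J hB hΨ₀ h2 hsρ (mul_le_of_le_one_left hρ0.le hs1.le) hB hγ
  · -- (T)
    intro γ hγ
    have hiter : ∀ k : ℕ, (fun γ' => e.symm (Ψ₀ (e γ')))^[k] γ = e.symm (Ψ₀^[k] (e γ)) := by
      intro k
      induction k with
      | zero => simp
      | succ k ih => rw [Function.iterate_succ_apply', Function.iterate_succ_apply', ih, ContinuousMulEquiv.apply_symm_apply]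
    have hc : Continuous (fun x => e.symm x) := e.symm.continuous
    have ht : Tendsto (fun x => e.symm x) (𝓝 1) (𝓝 (1 : ↥(«local» L (IsCMField.complexConj L) 3 (qsForm L) v))) := by
      simpa only [map_one] using hc.tendsto 1
    simp_rw [hiter]
    exact ht.comp (tendsto_iterate_cayleyScaling σ J hB hΨ₀ h2 hs1 hρ1 hγ)
  · -- (S)
    intro F hF
    have hF' : IsLocSmooth (F ∘ (fun x => e.symm x)) := isLocSmooth_comp_homeomorph e.symm.toHomeomorph hF
    have hS := isLocSmooth_indicator_comp_cayleyScaling σ J hB hΨ₀ h2 hs0 hs1.le hρ0 hρ1 hB' hΘ hF'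
    have heq : {γ : ↥(«local» L (IsCMField.complexConj L) 3 (qsForm L) v) | e γ ∈ B}.indicator (F ∘ fun γ => e.symm (Ψ₀ (e γ))) = (B.indicator ((F ∘ fun x => e.symm x) ∘ Ψ₀)) ∘ (fun γ => e γ) := by
      funext γ
      by_cases hγ : e γ ∈ B
      · rw [Function.comp_apply, indicator_of_mem hγ, indicator_of_mem (show γ ∈ {γ : ↥(«local» L (IsCMField.complexConj L) 3 (qsForm L) v) | e γ ∈ B} from hγ)]
        rfl
      · rw [Function.comp_apply, indicator_of_notMem hγ, indicator_of_notMem (show γ ∉ {γ : ↥(«local» L (IsCMField.complexConj L) 3 (qsForm L) v) | e γ ∈ B} from hγ)]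
    rw [heq]
    exact isLocSmooth_comp_homeomorph e.toHomeomorph hS
  · -- (SC)
    intro S mU hunip hadm u hu F hF
    refine hlaw (fun γ => e.symm (Ψ₀ (e γ))) {γ | e γ ∈ B} (fun γ => Iff.rfl) (fun γ hγ => ?_) S mU hunip hadm u hu F hF
    rw [ContinuousMulEquiv.apply_symm_apply]
    exact (hΨ₀ (e γ) hγ).1

set_option maxHeartbeats 1600000 in
/-- **THE CAYLEY SCALING PACKAGE: ‹SC-explicit› ⟹ ‹Ψ-package›** on `Gqs L v` — conclusion = the hypothesis `hΨ` of ★ p855276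
`K2E3ShalikaGermHomogeneityOfUnipotentScaling.shalikaGermHomogeneityRayRef_of_unipotentScaling` TOKEN FOR TOKEN; the definitional transport of `psiPackage_of_scalingLaw_local`
(`Gqs L v = ↥(UnitaryGroup.«local» L c 3 Φ₃ v)` by `rfl`).  See the module docstring for ‹SC-explicit› and the proof. [cite: Rogawski1990, §8.1 Prop. 8.1.2 (b) p. 114; (8.1.1) p. 116]
[cite: HarishChandra1999AdmissibleDistributions, §3.1 Lemma 3.2] [cite: PlatonovRapinchuk1994, §3.3; §5.1] -/
theorem psiPackage_of_scalingLaw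
    (hSC : ∀ (L : Type) [Field L] [NumberField L] [IsCMField L] (v : HeightOneSpectrum (𝓞 ↥(maximalRealSubfield L))),
      (∀ w : PlacesOver L v, IsCMField.complexConj L • w.1 = w.1) →
      ∀ [MeasurableSpace (Gqs L v)] [BorelSpace (Gqs L v)]
        [∀ γ : Gqs L v, MeasurableSpace (Gqs L v ⧸ Subgroup.centralizer ({γ} : Set (Gqs L v)))]
        [∀ γ : Gqs L v, BorelSpace (Gqs L v ⧸ Subgroup.centralizer ({γ} : Set (Gqs L v)))],
      ∃ (w : PlacesOver L v) (hw : IsCMField.complexConj L • w.1 = w.1) (s : w.1.adicCompletion L) (ρ : ℝ) (q : ℂ) (a : ConjClasses (Gqs L v) → ℕ),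
        galAdicCompletionMap (L := L) (IsCMField.complexConj L) hw s = s ∧ s ≠ 0 ∧ ‖s‖ < 1 ∧ 0 < ρ ∧ ρ < 1 ∧ 1 < ‖q‖ ∧
        (∀ u : ConjClasses (Gqs L v), u ≠ ConjClasses.mk 1 → 1 ≤ a u) ∧
        ∀ (Ψ : Gqs L v → Gqs L v) (U₀ : Set (Gqs L v)),
          (∀ γ : Gqs L v, γ ∈ U₀ ↔
            IsUnit ((((localNonsplitEquiv (IsCMField.complexConj L) (qsForm L) (IsCMField.complexConj_ne_one L) w hw γ : ↥(unitaryGroupOfForm (galAdicCompletionMap (L := L) (IsCMField.complexConj L) hw) (placeForm (qsForm L) w.1))) : GL (Fin 3) (w.1.adicCompletion L)) : Matrix (Fin 3) (Fin 3) (w.1.adicCompletion L)) + 1).det ∧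
            ‖(((((localNonsplitEquiv (IsCMField.complexConj L) (qsForm L) (IsCMField.complexConj_ne_one L) w hw γ : ↥(unitaryGroupOfForm (galAdicCompletionMap (L := L) (IsCMField.complexConj L) hw) (placeForm (qsForm L) w.1))) : GL (Fin 3) (w.1.adicCompletion L)) : Matrix (Fin 3) (Fin 3) (w.1.adicCompletion L)) - 1) *
                ((((localNonsplitEquiv (IsCMField.complexConj L) (qsForm L) (IsCMField.complexConj_ne_one L) w hw γ : ↥(unitaryGroupOfForm (galAdicCompletionMap (L := L) (IsCMField.complexConj L) hw) (placeForm (qsForm L) w.1))) : GL (Fin 3) (w.1.adicCompletion L)) : Matrix (Fin 3) (Fin 3) (w.1.adicCompletion L)) + 1)⁻¹).charpoly.coeff 2‖ ≤ ρ ∧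
            ‖(((((localNonsplitEquiv (IsCMField.complexConj L) (qsForm L) (IsCMField.complexConj_ne_one L) w hw γ : ↥(unitaryGroupOfForm (galAdicCompletionMap (L := L) (IsCMField.complexConj L) hw) (placeForm (qsForm L) w.1))) : GL (Fin 3) (w.1.adicCompletion L)) : Matrix (Fin 3) (Fin 3) (w.1.adicCompletion L)) - 1) *
                ((((localNonsplitEquiv (IsCMField.complexConj L) (qsForm L) (IsCMField.complexConj_ne_one L) w hw γ : ↥(unitaryGroupOfForm (galAdicCompletionMap (L := L) (IsCMField.complexConj L) hw) (placeForm (qsForm L) w.1))) : GL (Fin 3) (w.1.adicCompletion L)) : Matrix (Fin 3) (Fin 3) (w.1.adicCompletion L)) + 1)⁻¹).charpoly.coeff 1‖ ≤ ρ ^ 2 ∧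
            ‖(((((localNonsplitEquiv (IsCMField.complexConj L) (qsForm L) (IsCMField.complexConj_ne_one L) w hw γ : ↥(unitaryGroupOfForm (galAdicCompletionMap (L := L) (IsCMField.complexConj L) hw) (placeForm (qsForm L) w.1))) : GL (Fin 3) (w.1.adicCompletion L)) : Matrix (Fin 3) (Fin 3) (w.1.adicCompletion L)) - 1) *
                ((((localNonsplitEquiv (IsCMField.complexConj L) (qsForm L) (IsCMField.complexConj_ne_one L) w hw γ : ↥(unitaryGroupOfForm (galAdicCompletionMap (L := L) (IsCMField.complexConj L) hw) (placeForm (qsForm L) w.1))) : GL (Fin 3) (w.1.adicCompletion L)) : Matrix (Fin 3) (Fin 3) (w.1.adicCompletion L)) + 1)⁻¹).charpoly.coeff 0‖ ≤ ρ ^ 3) →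
          (∀ γ ∈ U₀,
            (((localNonsplitEquiv (IsCMField.complexConj L) (qsForm L) (IsCMField.complexConj_ne_one L) w hw (Ψ γ) : ↥(unitaryGroupOfForm (galAdicCompletionMap (L := L) (IsCMField.complexConj L) hw) (placeForm (qsForm L) w.1))) : GL (Fin 3) (w.1.adicCompletion L)) : Matrix (Fin 3) (Fin 3) (w.1.adicCompletion L)) =
              cayley (s • (((((localNonsplitEquiv (IsCMField.complexConj L) (qsForm L) (IsCMField.complexConj_ne_one L) w hw γ : ↥(unitaryGroupOfForm (galAdicCompletionMap (L := L) (IsCMField.complexConj L) hw) (placeForm (qsForm L) w.1))) : GL (Fin 3) (w.1.adicCompletion L)) : Matrix (Fin 3) (Fin 3) (w.1.adicCompletion L)) - 1) *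
                ((((localNonsplitEquiv (IsCMField.complexConj L) (qsForm L) (IsCMField.complexConj_ne_one L) w hw γ : ↥(unitaryGroupOfForm (galAdicCompletionMap (L := L) (IsCMField.complexConj L) hw) (placeForm (qsForm L) w.1))) : GL (Fin 3) (w.1.adicCompletion L)) : Matrix (Fin 3) (Fin 3) (w.1.adicCompletion L)) + 1)⁻¹))) →
          ∀ (S : Finset (ConjClasses (Gqs L v))) (mU : OrbitalMeasureFamily (Gqs L v)),
            (∀ u ∈ S, (((Quotient.out u : Gqs L v).val : GL (Fin 3) (UnitaryGroup.LocalRing L v)).val - 1) ^ 3 = 0) →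
            mU.IsAdmissibleOn (fun γ : Gqs L v => (ConjClasses.mk γ) ∈ S) →
            ∀ u ∈ S, ∀ F : Gqs L v → ℂ, IsLocSmooth F →
              classOrbitalIntegral mU (U₀.indicator (F ∘ Ψ)) u = q ^ (a u) * classOrbitalIntegral mU F u) :
    ∀ (L : Type) [Field L] [NumberField L] [IsCMField L] (v : HeightOneSpectrum (𝓞 ↥(maximalRealSubfield L))),
      (∀ w : PlacesOver L v, IsCMField.complexConj L • w.1 = w.1) →
      ∀ [MeasurableSpace (Gqs L v)] [BorelSpace (Gqs L v)]
        [∀ γ : Gqs L v, MeasurableSpace (Gqs L v ⧸ Subgroup.centralizer ({γ} : Set (Gqs L v)))]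
        [∀ γ : Gqs L v, BorelSpace (Gqs L v ⧸ Subgroup.centralizer ({γ} : Set (Gqs L v)))],
      ∃ (Ψ : Gqs L v → Gqs L v) (U₀ : Set (Gqs L v)) (q : ℂ) (a : ConjClasses (Gqs L v) → ℕ),
        U₀ ∈ 𝓝 (1 : Gqs L v) ∧
        (∀ γ ∈ U₀, ∀ x : Gqs L v, x * γ * x⁻¹ ∈ U₀) ∧
        (∀ γ ∈ U₀, ∀ x : Gqs L v, Ψ (x * γ * x⁻¹) = x * Ψ γ * x⁻¹) ∧
        (∀ γ ∈ U₀, ∀ z : Gqs L v, z * γ = γ * z ↔ z * Ψ γ = Ψ γ * z) ∧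
        (∀ γ ∈ U₀, IsRegularElt (γ.val : GL (Fin 3) (UnitaryGroup.LocalRing L v)) → IsRegularElt ((Ψ γ).val : GL (Fin 3) (UnitaryGroup.LocalRing L v))) ∧
        (∀ γ ∈ U₀, Ψ γ ∈ U₀) ∧
        (∀ γ ∈ U₀, Tendsto (fun k : ℕ => Ψ^[k] γ) atTop (𝓝 (1 : Gqs L v))) ∧
        (∀ F : Gqs L v → ℂ, IsLocSmooth F → IsLocSmooth (U₀.indicator (F ∘ Ψ))) ∧
        1 < ‖q‖ ∧
        (∀ u : ConjClasses (Gqs L v), u ≠ ConjClasses.mk 1 → 1 ≤ a u) ∧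
        ∀ (S : Finset (ConjClasses (Gqs L v))) (mU : OrbitalMeasureFamily (Gqs L v)),
          (∀ u ∈ S, (((Quotient.out u : Gqs L v).val : GL (Fin 3) (UnitaryGroup.LocalRing L v)).val - 1) ^ 3 = 0) →
          mU.IsAdmissibleOn (fun γ : Gqs L v => (ConjClasses.mk γ) ∈ S) →
          ∀ u ∈ S, ∀ F : Gqs L v → ℂ, IsLocSmooth F →
            classOrbitalIntegral mU (U₀.indicator (F ∘ Ψ)) u = q ^ (a u) * classOrbitalIntegral mU F u :=
  psiPackage_of_scalingLaw_local hSC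

end Summit.HodgeConjecture.HodgeConjecture.Cruxes.H413.K2E3CayleyScalingPackage

end
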